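import Mathlib
import HarnessLib
import Literature.Probability.LatticeModels.IsingThermodynamics
import Literature.Probability.LatticeModels.AxisSpectralRepresentationProofs
import Literature.Probability.LatticeModels.CriticalTwoPointBounds

/-!
# Slab spectral representation of the critical two-point function of the 3D Ising model

Stub `stub_slabSpectralRepresentation` of line `self-energy-pick-inversion`, crux
`PrecisionLaplacian.DirectCorrelationStableTail` (stmt-CriticalPhenomena-4799): the
finitely-supported-`v` form of Aizenman–Duminil-Copin 2021, Prop. 8.6 (= Prop. 5.3, arXiv:1912.07973
App. §8.3) for the nearest-neighbour Ising model on `ℤ³` AT `β = β_c(3)`, in every coordinate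
direction `i`, in Hausdorff-moment form: for every finite `s ⊂ ℤ²` and `v : ℤ² → ℝ` there is a
finite positive measure `μ` on `[0, 1]` with
`∑_{x,y ∈ s} v x v y ⟨σ₀ σ_{ins_i(n, x - y)}⟩⁺_{β_c} = ∫ tⁿ dμ(t)` for all `n : ℕ`
(package form `HasSlabSpectralRepresentation (criticalTwoPoint 3)`).

## Proof

Literature-level statement first (`exists_axisForm_hausdorffMeasure`): for the Ising model on
`ℤ^{d'+1}` at any `β ≥ 0` with `m*(β) = 0` (which holds at `β_c(3)`: ADS 2015,
`spontaneousMagnetization_criticalBeta_eq_zero_holds`), every axis `i` and real coefficients `c_a`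
at points `x_a` of the hyperplane `{x_i = 0}`, the axis form
`W(n) = ∑_{a,b} c_a c_b ⟨σ₀ σ_{x_b - x_a + n e_i}⟩⁺_β` (`axisForm`, `TwoPointLogConvex.lean`) is the
moment sequence of a finite positive measure on `[0, 1]`. Steps, following the printed proof and
the tree's proof of the `v = δ` case (`AxisSpectralRepresentationProofs.lean`):

* torus `(ℤ/Nℤ)^{d'+1}`, `N ≥ 3`: `Z · W_N(n) = Tr(diag F · Aⁿ · diag F · A^{N-n})` for the layer
  observable `F = ∑_a c_a σ_{x_a}` and the positive semidefinite symmetrised transfer matrix `A`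
  (`Z_mul_torusAxisForm_eq_trace`, `trace_diagonal_pow_diagonal_pow_eq_sum`), whence
  `W_N(n) = ∫ tⁿ dν_N` for `0 ≤ n < N` with the finitely supported positive measure
  `ν_N = ∑_{k,l} (c_{kl} λ_k^N / Z) δ_{λ_l/λ_k}` on `[0, ∞)` (`exists_atomicMeasure_of_spectralSum`,
  `exists_torusAxisForm_moments`); its moments are `≤ (∑_a |c_a|)²` (`torusAxisForm_le_sq_sum_abs`);
* `N → ∞`: `W_N(n) → W(n)` when `m*(β) = 0` (`tendsto_torusAxisForm`, ADC Prop. 5.2), and the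
  moment criterion (`exists_hausdorffMeasure_of_momentLimit`: restrict to `[0, 2]` where the tails
  are `O(2^{n-N})`, take a weak cluster point by Mathlib's compactness of finite measures of bounded
  mass on a compact set, read off the moments, kill `(1, 2]` by the uniform moment bound). Unlike
  the Laplace form `∫ e^{-a|n|} dμ(a)` of the `v = δ` file, the Hausdorff form tolerates an atom at
  `t = 0`, so no intertwiner estimate is needed;
* the stub: `d' = 2`, `β = β_c(3) ≥ 0`, index type `s`, `c = v|_s`, `x_a = ins_i(0, a)`,
  `ins_i(0, y) - ins_i(0, x) + n e_i = ins_i(n, y - x)`, and the order of summation is swapped.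

Sources: M. Aizenman, H. Duminil-Copin, Ann. of Math. 194 (2021), arXiv:1912.07973, App. §8.3
Prop. 8.6 (= Prop. 5.3) and its proof [AizenmanDuminilCopinAnnals2021]; J. Glimm, A. Jaffe,
*Quantum Physics* §6.1. Pure theorem file: no definitions.
-/

noncomputable section

namespace Summit.CriticalPhenomena.Ising3DConformalLimit.Cruxes.DirectCorrelationStableTail.SelfEnergyPickInversion

open MeasureTheory Filter Topology Set
open scoped BigOperators BoundedContinuousFunction
open Literature.Probability.LatticeModels

/-! ### Finite atomic spectral measures -/

/-- **The atomic measure of a spectral sum.** For weights `c_{kl} ≥ 0`, `λ_k ≥ 0`, `Z > 0` and a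
length `N`, the finitely supported positive measure `ν = ∑_{k,l} (c_{kl} λ_k^N / Z) δ_{λ_l/λ_k}` on
`[0, ∞)` has moments `∫ tᵐ dν = Z⁻¹ ∑_{k,l} c_{kl} λ_lᵐ λ_k^{N-m}` for `0 ≤ m < N` (terms with
`λ_k = 0` vanish on both sides). Stated as an existence result (no definitions in this file).
[cite: AizenmanDuminilCopinAnnals2021, Appendix §8.3, proof of Prop. 8.6, eq. (212)] -/
theorem exists_atomicMeasure_of_spectralSum {κ : Type*} [Fintype κ] (cc : κ → κ → ℝ) (ev : κ → ℝ)
    (hcc : ∀ k l, 0 ≤ cc k l) (hev : ∀ k, 0 ≤ ev k) {Z : ℝ} (hZ : 0 < Z) (N : ℕ) :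
    ∃ ν : Measure ℝ, IsFiniteMeasure ν ∧ ν (Set.Iio 0) = 0 ∧ (∀ g : ℝ → ℝ, Integrable g ν) ∧
      ∀ m : ℕ, m < N → ∫ t, t ^ m ∂ν = Z⁻¹ * ∑ k, ∑ l, cc k l * (ev l ^ m * ev k ^ (N - m)) := by
  classical
  set w : κ → κ → ℝ := fun k l => cc k l * ev k ^ N / Z with hw
  set x : κ → κ → ℝ := fun k l => ev l / ev k with hx
  have hw0 : ∀ k l, 0 ≤ w k l := fun k l =>
    div_nonneg (mul_nonneg (hcc k l) (pow_nonneg (hev k) N)) hZ.le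
  have hx0 : ∀ k l, 0 ≤ x k l := fun k l => div_nonneg (hev l) (hev k)
  let ν : Measure ℝ := ∑ p : κ × κ, ENNReal.ofReal (w p.1 p.2) • Measure.dirac (x p.1 p.2)
  have hνapply : ∀ s : Set ℝ, MeasurableSet s →
      ν s = ∑ p : κ × κ, ENNReal.ofReal (w p.1 p.2) * s.indicator 1 (x p.1 p.2) := by
    intro s hs
    simp only [ν, Measure.coe_finsetSum, Finset.sum_apply, Measure.smul_apply, smul_eq_mul,
      Measure.dirac_apply' _ hs]
  have hint : ∀ g : ℝ → ℝ, Integrable g ν := fun g =>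
    integrable_finsetSum_measure.2 fun p _ =>
      (AxisSpectral.integrable_dirac_real g _).smul_measure ENNReal.ofReal_ne_top
  have hintegral : ∀ g : ℝ → ℝ, ∫ t, g t ∂ν = ∑ p : κ × κ, w p.1 p.2 * g (x p.1 p.2) := by
    intro g
    rw [integral_finsetSum_measure fun p _ =>
      (AxisSpectral.integrable_dirac_real g _).smul_measure ENNReal.ofReal_ne_top]
    refine Finset.sum_congr rfl fun p _ => ?_
    rw [integral_smul_measure, integral_dirac, ENNReal.toReal_ofReal (hw0 _ _), smul_eq_mul]
  refine ⟨ν, ⟨?_⟩, ?_, hint, fun m hm => ?_⟩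
  · rw [hνapply _ MeasurableSet.univ]
    exact ENNReal.sum_lt_top.2 fun p _ => ENNReal.mul_lt_top ENNReal.ofReal_lt_top (by simp)
  · rw [hνapply _ measurableSet_Iio]
    refine Finset.sum_eq_zero fun p _ => ?_
    rw [Set.indicator_of_notMem (by simpa using hx0 p.1 p.2), mul_zero]
  · rw [hintegral, Fintype.sum_prod_type]
    have hterm : ∀ k l, w k l * x k l ^ m = Z⁻¹ * (cc k l * (ev l ^ m * ev k ^ (N - m))) := by
      intro k l
      simp only [hw, hx]
      rcases (hev k).eq_or_lt with hk | hk
      · rw [← hk, zero_pow (by omega : N ≠ 0), zero_pow (by omega : N - m ≠ 0)]; simp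
      · rw [div_pow]
        have hsplit : ev k ^ N = ev k ^ m * ev k ^ (N - m) := by
          rw [← pow_add]; congr 1; omega
        rw [hsplit]
        field_simp
    simp_rw [hterm, ← Finset.mul_sum]

/-! ### The torus: axis forms of the periodic two-point function are truncated moment sequences -/

/-- **Finite-volume spectral representation of axis forms** (ADC 2021, App. §8.3, eq. (212), "the
positivity of the transfer matrix", for a general layer observable): on the torus `(ℤ/Nℤ)^{d'+1}`,
`N ≥ 3`, at `β ≥ 0` and zero field, for coefficients `c_a` at sites `x_a` of the layer `{x_i = 0}`
the axis form `W_N(m) = ∑_{a,b} c_a c_b ⟨σ_{x_a} σ_{x_b + m e_i}⟩_{𝕋_N;β}` satisfies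
`W_N(m) = ∫ tᵐ dν` for `0 ≤ m < N`, for a finitely supported positive measure `ν` on `[0, ∞)`.
[cite: AizenmanDuminilCopinAnnals2021, Appendix §8.3, proof of Prop. 8.6, eq. (212)] -/
theorem exists_torusAxisForm_moments {d' N : ℕ} [NeZero N] (hN : 3 ≤ N) {β : ℝ} (hβ : 0 ≤ β)
    (i : Fin (d' + 1)) {ι : Type*} [Fintype ι] (c : ι → ℝ) (x : ι → TorusSite (d' + 1) N)
    (hx : ∀ a, x a i = 0) :
    ∃ ν : Measure ℝ, IsFiniteMeasure ν ∧ ν (Set.Iio 0) = 0 ∧ (∀ g : ℝ → ℝ, Integrable g ν) ∧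
      ∀ m : ℕ, m < N → ∫ t, t ^ m ∂ν = torusAxisForm β i c x (m : ZMod N) := by
  classical
  set Z := isingPartitionFunction (torusGraph (d' + 1) N) Finset.univ β 0 .free with hZ
  have hZpos : 0 < Z := isingPartitionFunction_pos _ _ β 0 _
  obtain ⟨ev, cc, hev, hcc, -, hspec⟩ :=
    trace_diagonal_pow_diagonal_pow_eq_sum (transferMatrix_posSemidef (d' := d') (N := N) hβ 0)
      (fun r : Layer d' N => ∑ a, c a * spinAt (i.removeNth (x a)) r)
  obtain ⟨ν, hfin, hsupp, hint, hmom⟩ := exists_atomicMeasure_of_spectralSum cc ev hcc hev hZpos N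
  refine ⟨ν, hfin, hsupp, hint, fun m hm => ?_⟩
  have hval : ((m : ZMod N)).val = m := ZMod.val_cast_of_lt hm
  have hrep : Z * torusAxisForm β i c x (m : ZMod N) = ∑ k, ∑ l, cc k l * (ev l ^ m * ev k ^ (N - m)) := by
    rw [hZ, Z_mul_torusAxisForm_eq_trace hN β i c x hx, hval]
    exact hspec m (N - m)
  rw [hmom m hm, ← hrep, ← mul_assoc, inv_mul_cancel₀ hZpos.ne', one_mul]

/-- **Uniform bound on torus axis forms**: `W_N(n) ≤ (∑_a |c_a|)²`, since
`0 ≤ ⟨σ_u σ_v⟩_{𝕋_N;β} ≤ 1` for `β ≥ 0` (GKS I and `|σ| = 1`). [folklore] -/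
theorem torusAxisForm_le_sq_sum_abs {d' N : ℕ} [NeZero N] {β : ℝ} (hβ : 0 ≤ β) (i : Fin (d' + 1))
    {ι : Type*} [Fintype ι] (c : ι → ℝ) (x : ι → TorusSite (d' + 1) N) (n : ZMod N) :
    torusAxisForm β i c x n ≤ (∑ a, |c a|) ^ 2 := by
  have hterm : ∀ a b, c a * c b * isingTorusTwoPoint (d' + 1) N β 0 (x a) (x b + Pi.single i n) ≤
      |c a| * |c b| := by
    intro a b
    have h1 := isingTorusTwoPoint_le_one β 0 (x a) (x b + Pi.single i n)
    have h0 := isingTorusTwoPoint_nonneg hβ (x a) (x b + Pi.single i n)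
    have h2 : c a * c b ≤ |c a| * |c b| := by rw [← abs_mul]; exact le_abs_self _
    nlinarith [mul_nonneg (abs_nonneg (c a)) (abs_nonneg (c b))]
  rw [torusAxisForm, sq, Finset.sum_mul_sum]
  exact Finset.sum_le_sum fun a _ => Finset.sum_le_sum fun b _ => hterm a b

/-! ### The limit: approximately-Hausdorff moment data give a Hausdorff moment sequence -/

/-- **The moment criterion on a bounded interval** ("the moment criterion for the convergence of
positive measures over bounded intervals (here `[0,1]`)", last paragraph of the proof of ADC 2021
Prop. 8.6), in the form needed here: if finite positive measures `ν_j` on `[0, ∞)` have moments of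
order `n ≤ j` bounded by `M` and `∫ tⁿ dν_j → u(n)` for every `n`, then `u(n) = ∫ tⁿ dμ` for a
finite positive measure `μ` on `[0, 1]` (all `n : ℕ`; an atom at `t = 0` is allowed). Proof:
restrict to `[0, 2]` (tails `≤ M 2^{n-j}`), take a weak cluster point (compactness of finite
measures of mass `≤ M` on a compact set, Mathlib's `isCompact_setOf_finiteMeasure_le_of_isCompact`),
read off the moments with truncated powers, and kill `(1, 2]` with `u(n) ≤ M`.
[cite: AizenmanDuminilCopinAnnals2021, Appendix §8.3, proof of Prop. 8.6 (last paragraph)] -/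
theorem exists_hausdorffMeasure_of_momentLimit (u : ℕ → ℝ) (ν : ℕ → Measure ℝ)
    (hfin : ∀ j, IsFiniteMeasure (ν j)) {M : ℝ} (hsupp : ∀ j, ν j (Iio 0) = 0)
    (hint : ∀ j n, Integrable (fun x : ℝ => x ^ n) (ν j))
    (hle : ∀ j n, n ≤ j → ∫ x, x ^ n ∂(ν j) ≤ M)
    (hlim : ∀ n, Tendsto (fun j => ∫ x, x ^ n ∂(ν j)) atTop (𝓝 (u n))) :
    ∃ μ : Measure ℝ, IsFiniteMeasure μ ∧ μ (Set.Icc (0 : ℝ) 1)ᶜ = 0 ∧ ∀ n : ℕ, u n = ∫ t, t ^ n ∂μ := by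
  classical
  set K : Set ℝ := Icc 0 2 with hKdef
  have hK : IsCompact K := isCompact_Icc
  have hKm : MeasurableSet K := measurableSet_Icc
  have hae0 : ∀ j, ∀ᵐ x ∂(ν j), 0 ≤ x := fun j =>
    (measure_eq_zero_iff_ae_notMem.1 (hsupp j)).mono fun x hx => not_lt.1 hx
  have huM : ∀ n, u n ≤ M := fun n =>
    le_of_tendsto (hlim n) (eventually_atTop.2 ⟨n, fun j hj => hle j n hj⟩)
  /- Step 1: the truncated moments converge: `∫_K tⁿ dν_j → u(n)` (tail `≤ M 2^{n-j}`). -/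
  have htail : ∀ n j, n ≤ j →
      0 ≤ ∫ x in Kᶜ, x ^ n ∂(ν j) ∧ ∫ x in Kᶜ, x ^ n ∂(ν j) ≤ M * (1 / 2) ^ (j - n) := by
    intro n j hnj
    haveI := hfin j
    have haeK : ∀ᵐ x ∂(ν j).restrict Kᶜ, 2 < x := by
      filter_upwards [ae_restrict_mem hKm.compl, ae_restrict_of_ae (hae0 j)] with x hx hx0
      simp only [hKdef, mem_compl_iff, mem_Icc, not_and_or, not_le] at hx
      rcases hx with hx | hx
      · exact absurd hx0 (not_le.2 hx)
      · exact hx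
    have hpt : ∀ x : ℝ, 2 < x → 0 ≤ x ^ n ∧ x ^ n ≤ x ^ j * (1 / 2) ^ (j - n) := by
      intro x hx
      have hx0 : 0 ≤ x := by linarith
      refine ⟨pow_nonneg hx0 n, ?_⟩
      have h2 : (2 : ℝ) ^ (j - n) ≤ x ^ (j - n) := pow_le_pow_left₀ (by norm_num) hx.le _
      have hxj : x ^ j = x ^ n * x ^ (j - n) := by rw [← pow_add]; congr 1; omega
      rw [hxj, one_div_pow, mul_one_div, le_div_iff₀ (pow_pos (by norm_num : (0 : ℝ) < 2) _)]
      exact mul_le_mul_of_nonneg_left h2 (pow_nonneg hx0 n)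
    constructor
    · exact integral_nonneg_of_ae (haeK.mono fun x hx => (hpt x hx).1)
    · calc ∫ x in Kᶜ, x ^ n ∂(ν j) ≤ ∫ x in Kᶜ, x ^ j * (1 / 2) ^ (j - n) ∂(ν j) :=
            integral_mono_ae (hint j n).integrableOn ((hint j j).mul_const _).integrableOn
              (haeK.mono fun x hx => (hpt x hx).2)
        _ = (∫ x in Kᶜ, x ^ j ∂(ν j)) * (1 / 2) ^ (j - n) := integral_mul_const _ _
        _ ≤ (∫ x, x ^ j ∂(ν j)) * (1 / 2) ^ (j - n) := by
            refine mul_le_mul_of_nonneg_right ?_ (pow_nonneg (by norm_num) _)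
            exact setIntegral_le_integral (hint j j) ((hae0 j).mono fun x hx => pow_nonneg hx j)
        _ ≤ M * (1 / 2) ^ (j - n) :=
            mul_le_mul_of_nonneg_right (hle j j le_rfl) (pow_nonneg (by norm_num) _)
  have htrunc : ∀ n, Tendsto (fun j => ∫ x in K, x ^ n ∂(ν j)) atTop (𝓝 (u n)) := by
    intro n
    have hsplit : ∀ j, ∫ x in K, x ^ n ∂(ν j) = ∫ x, x ^ n ∂(ν j) - ∫ x in Kᶜ, x ^ n ∂(ν j) := by
      intro j
      rw [← integral_add_compl hKm (hint j n)]
      ring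
    simp_rw [hsplit]
    rw [← sub_zero (u n)]
    refine (hlim n).sub ?_
    have hgeom : Tendsto (fun j : ℕ => M * (1 / 2 : ℝ) ^ (j - n)) atTop (𝓝 0) := by
      have h := ((tendsto_pow_atTop_nhds_zero_of_lt_one (by norm_num : (0 : ℝ) ≤ 1 / 2)
        (by norm_num)).comp (tendsto_sub_atTop_nat n)).const_mul M
      simpa using h
    refine tendsto_of_tendsto_of_tendsto_of_le_of_le' tendsto_const_nhds hgeom ?_ ?_
    · exact eventually_atTop.2 ⟨n, fun j hj => (htail n j hj).1⟩
    · exact eventually_atTop.2 ⟨n, fun j hj => (htail n j hj).2⟩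
  /- Step 2: a weak cluster point `ν̄` of the restrictions to `K`. -/
  let ρ : ℕ → FiniteMeasure ℝ := fun j => ⟨(ν j).restrict K, by haveI := hfin j; infer_instance⟩
  have hρcoe : ∀ j, ((ρ j : FiniteMeasure ℝ) : Measure ℝ) = (ν j).restrict K := fun j => rfl
  set S : Set (FiniteMeasure ℝ) := {μ | μ.mass ≤ M.toNNReal ∧ μ Kᶜ = 0} with hSdef
  have hS : IsCompact S := isCompact_setOf_finiteMeasure_le_of_isCompact M.toNNReal hK
  have hρS : ∀ j, ρ j ∈ S := by
    intro j
    haveI := hfin j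
    constructor
    · have h1 : (ν j) univ ≤ ENNReal.ofReal M := by
        have h := hle j 0 (Nat.zero_le j)
        simp only [pow_zero, integral_const, smul_eq_mul, mul_one] at h
        have : (ν j) univ = ENNReal.ofReal ((ν j).real univ) :=
          (ofReal_measureReal (by finiteness)).symm
        rw [this]
        exact ENNReal.ofReal_le_ofReal h
      have h2 : ((ρ j : FiniteMeasure ℝ) : Measure ℝ) univ ≤ ENNReal.ofReal M := by
        rw [hρcoe, Measure.restrict_apply MeasurableSet.univ, univ_inter]
        exact (measure_mono (subset_univ _)).trans h1
      have h3 : ((ρ j).mass : ENNReal) ≤ ((M.toNNReal : NNReal) : ENNReal) := by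
        rw [FiniteMeasure.ennreal_mass]; exact h2
      exact_mod_cast h3
    · rw [FiniteMeasure.null_iff_toMeasure_null, hρcoe, Measure.restrict_apply hKm.compl,
        compl_inter_self, measure_empty]
  have hleS : (atTop : Filter ℕ).map ρ ≤ 𝓟 S :=
    le_principal_iff.2 (mem_map.2 (univ_mem' fun j => hρS j))
  obtain ⟨νbar, hνbarS, hclu⟩ := hS.exists_clusterPt hleS
  have hclu' : MapClusterPt νbar atTop ρ := hclu
  set μb : Measure ℝ := (νbar : Measure ℝ) with hμb
  have hμbK : μb Kᶜ = 0 := (FiniteMeasure.null_iff_toMeasure_null νbar Kᶜ).1 hνbarS.2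
  have haeK : ∀ᵐ x ∂μb, x ∈ K := by
    have := measure_eq_zero_iff_ae_notMem.1 hμbK
    exact this.mono fun x hx => of_not_not hx
  /- Step 3: integrals of bounded continuous functions along the cluster point; moments. -/
  have hcluInt : ∀ g : ℝ →ᵇ ℝ,
      MapClusterPt (∫ x, g x ∂μb) atTop (fun j => ∫ x, g x ∂(ρ j : Measure ℝ)) := by
    intro g
    have hcont : Continuous fun μ : FiniteMeasure ℝ => ∫ x, g x ∂(μ : Measure ℝ) :=
      FiniteMeasure.continuous_integral_boundedContinuousFunction g
    exact hclu'.tendsto_comp (hcont.tendsto νbar)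
  have hmomK : ∀ n, ∫ x, x ^ n ∂μb = u n := by
    intro n
    obtain ⟨g, hg⟩ := AxisSpectral.exists_bcf_eq_pow n
    have h1 : ∀ j, ∫ x, g x ∂(ρ j : Measure ℝ) = ∫ x in K, x ^ n ∂(ν j) := by
      intro j
      rw [hρcoe]
      exact setIntegral_congr_fun hKm fun x hx => hg x hx
    have h2 : ∫ x, g x ∂μb = u n := by
      refine AxisSpectral.eq_of_mapClusterPt_of_tendsto (hcluInt g) ?_
      simp_rw [h1]
      exact htrunc n
    rw [← h2]
    exact integral_congr_ae (haeK.mono fun x hx => (hg x hx).symm)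
  have hintb : ∀ n, Integrable (fun x : ℝ => x ^ n) μb := fun n => by
    obtain ⟨g, hg⟩ := AxisSpectral.exists_bcf_eq_pow n
    exact (g.integrable μb).congr (haeK.mono fun x hx => hg x hx)
  /- Step 4: no mass above `1` (`cⁿ ν̄((c, ∞)) ≤ u(n) ≤ M` for every `n`). -/
  have hone_b : μb (Ioi 1) = 0 := by
    have hc : ∀ c : ℝ, 1 < c → μb (Ioi c) = 0 := by
      intro c hc
      have hc0 : 0 ≤ c := by linarith
      have hbound : ∀ n : ℕ, μb.real (Ioi c) ≤ M * (1 / c) ^ n := by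
        intro n
        have h1 : c ^ n * μb.real (Ioi c) ≤ M := by
          calc c ^ n * μb.real (Ioi c) = ∫ x, (Ioi c).indicator (fun _ => c ^ n) x ∂μb := by
                rw [integral_indicator_const _ measurableSet_Ioi, smul_eq_mul, mul_comm]
            _ ≤ ∫ x, x ^ n ∂μb := by
                refine integral_mono_ae ((integrable_const _).indicator measurableSet_Ioi)
                  (hintb n) ?_
                filter_upwards [haeK] with x hx
                by_cases hxc : x ∈ Ioi c
                · rw [indicator_of_mem hxc]
                  exact pow_le_pow_left₀ hc0 (le_of_lt hxc) n
                · rw [indicator_of_notMem hxc]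
                  exact pow_nonneg hx.1 n
            _ = u n := hmomK n
            _ ≤ M := huM n
        rw [one_div_pow, mul_one_div, le_div_iff₀ (pow_pos (by linarith) n), mul_comm]
        exact h1
      have hlim0 : Tendsto (fun n : ℕ => M * (1 / c) ^ n) atTop (𝓝 0) := by
        have h := (tendsto_pow_atTop_nhds_zero_of_lt_one (by positivity)
          ((div_lt_one (by linarith)).2 hc)).const_mul M
        simpa using h
      have hle0 : μb.real (Ioi c) ≤ 0 := ge_of_tendsto hlim0 (Eventually.of_forall hbound)
      exact (measureReal_eq_zero_iff (by finiteness)).1 (le_antisymm hle0 measureReal_nonneg)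
    have hcover : Ioi (1 : ℝ) ⊆ ⋃ m : ℕ, Ioi (1 + 1 / ((m : ℝ) + 1)) := by
      intro x hx
      obtain ⟨m, hm⟩ := exists_nat_one_div_lt (sub_pos.2 (mem_Ioi.1 hx))
      exact mem_iUnion.2 ⟨m, by rw [mem_Ioi]; linarith⟩
    refine measure_mono_null hcover (measure_iUnion_null fun m => hc _ ?_)
    have : 0 < 1 / ((m : ℝ) + 1) := by positivity
    linarith
  /- Conclusion: `ν̄` is carried by `[0, 1] ⊇ K \ (1, ∞)`. -/
  refine ⟨μb, inferInstance, ?_, fun n => (hmomK n).symm⟩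
  refine measure_mono_null (fun x hx => ?_) (measure_union_null hμbK hone_b)
  simp only [mem_compl_iff, mem_Icc, not_and_or, not_le] at hx
  simp only [hKdef, mem_union, mem_compl_iff, mem_Icc, mem_Ioi, not_and_or, not_le]
  rcases hx with hx | hx
  · exact Or.inl (Or.inl hx)
  · exact Or.inr hx

/-! ### Infinite volume: axis forms of `⟨σ₀σ_x⟩⁺_β` are Hausdorff moment sequences when `m*(β) = 0` -/

/-- **Aizenman–Duminil-Copin 2021, Prop. 8.6 (= Prop. 5.3) for finitely supported `v`,
Hausdorff-moment form, nearest-neighbour Ising model, regime `m*(β) = 0`.** For `β ≥ 0` with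
`spontaneousMagnetization (d'+1) β = 0` (all `β < β_c`; `β = β_c` for `d' + 1 ≥ 3`), every axis
`i`, and real coefficients `c_a` at lattice points `x_a` of the hyperplane `{x_i = 0}`, there is
a finite positive measure `μ` on `[0, 1]` with
`∑_{a,b} c_a c_b ⟨σ₀ σ_{x_b - x_a + n e_i}⟩⁺_β = ∫ tⁿ dμ(t)` for all `n : ℕ` (printed:
"`∑ v_{x_⊥} v̄_{y_⊥} S_β((n, x_⊥ − y_⊥)) = ∫₀^∞ e^{−a|n|} dμ_{v,β}(a)`", `t = e^{-a}`). Proof: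
torus transfer-matrix representation (`exists_torusAxisForm_moments`), convergence of the
periodic two-point function (`tendsto_torusAxisForm`, ADC Prop. 5.2) and the moment criterion
(`exists_hausdorffMeasure_of_momentLimit`).
[cite: AizenmanDuminilCopinAnnals2021, Appendix §8.3 Prop. 8.6 (= Prop. 5.3) and its proof] -/
theorem exists_axisForm_hausdorffMeasure {d' : ℕ} {β : ℝ} (hβ : 0 ≤ β)
    (hm : spontaneousMagnetization (d' + 1) β = 0) (i : Fin (d' + 1)) {ι : Type*} [Fintype ι]
    (c : ι → ℝ) (x : ι → Site (d' + 1)) (hx : ∀ a, x a i = 0) :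
    ∃ μ : Measure ℝ, IsFiniteMeasure μ ∧ μ (Set.Icc (0 : ℝ) 1)ᶜ = 0 ∧
      ∀ n : ℕ, axisForm β i c x n = ∫ t, t ^ n ∂μ := by
  classical
  have hproj : ∀ (j : ℕ) (a : ι), Torus.proj (j + 3) (x a) i = 0 := fun j a => by simp [hx a]
  have hex : ∀ j : ℕ, ∃ ν : Measure ℝ, IsFiniteMeasure ν ∧ ν (Set.Iio 0) = 0 ∧
      (∀ g : ℝ → ℝ, Integrable g ν) ∧
      ∀ m : ℕ, m < j + 3 → ∫ t, t ^ m ∂ν =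
        torusAxisForm (N := j + 3) β i c (fun a => Torus.proj (j + 3) (x a)) (m : ZMod (j + 3)) :=
    fun j => exists_torusAxisForm_moments (N := j + 3) (by omega) hβ i c _ (hproj j)
  choose ν hfin hsupp hint hmom using hex
  refine exists_hausdorffMeasure_of_momentLimit (M := (∑ a, |c a|) ^ 2) (axisForm β i c x) ν hfin
    hsupp (fun j n => hint j _) (fun j n hnj => ?_) (fun n => ?_)
  · rw [hmom j n (by omega)]
    exact torusAxisForm_le_sq_sum_abs hβ i c _ _
  · refine (tendsto_torusAxisForm hβ hm i c x n).congr' ?_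
    rw [EventuallyEq, eventually_atTop]
    exact ⟨n, fun j hj => (hmom j n (by omega)).symm⟩

/-! ### The stub -/

/-- Slab points along the axis `i`: `ins_i(0, b) - ins_i(0, a) + n e_i = ins_i(n, b - a)` in
`ℤ³ = ℤ × ℤ²` (coordinate `i` singled out). [folklore] -/
theorem insertNth_zero_sub_add_single (i : Fin 3) (n : ℤ) (a b : Fin 2 → ℤ) :
    (Fin.insertNth i (0 : ℤ) b : Site 3) - Fin.insertNth i 0 a + Pi.single i n = Fin.insertNth i n (b - a) := by
  rw [← Fin.insertNth_sub, ← Fin.insertNth_zero_right, ← Fin.insertNth_add]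
  simp

/-- **Registered stub `stub_slabSpectralRepresentation`** (signature EXACTLY as registered on
stmt-CriticalPhenomena-4799; package form `HasSlabSpectralRepresentation (criticalTwoPoint 3)`):
the finitely-supported-`v` form of Aizenman–Duminil-Copin 2021 Prop. 8.6 (= Prop. 5.3,
arXiv:1912.07973 App. §8.3) for the nearest-neighbour Ising model on `ℤ³` at `β = β_c(3)`, in each
coordinate direction `i`: for every finite `s ⊂ ℤ²` and `v : ℤ² → ℝ` there is a finite positive
measure `μ` on `[0, 1]` with `∑_{x,y ∈ s} v x v y G(ins_i(n, x − y)) = ∫ tⁿ dμ` for all `n : ℕ`,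
`G = criticalTwoPoint 3 = ⟨σ₀σ_·⟩⁺_{β_c(3)}`. Proof: `exists_axisForm_hausdorffMeasure` at `d' = 2`,
`β = β_c(3) ≥ 0` (`criticalBeta_nonneg`), `m*(β_c(3)) = 0`
(`spontaneousMagnetization_criticalBeta_eq_zero_holds`, ADS 2015), with index type `s`,
coefficients `v|_s` and points `ins_i(0, a)`; then `ins_i(0, y) - ins_i(0, x) + n e_i = ins_i(n, y - x)`
and the order of summation is swapped.
[cite: AizenmanDuminilCopinAnnals2021, Appendix §8.3 Prop. 8.6 (= Prop. 5.3)] -/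
theorem stub_slabSpectralRepresentation :
    (∀ (i : Fin 3) (s : Finset (Fin 2 → ℤ)) (v : (Fin 2 → ℤ) → ℝ), ∃ μ : MeasureTheory.Measure ℝ,
      MeasureTheory.IsFiniteMeasure μ ∧ μ (Set.Icc (0 : ℝ) 1)ᶜ = 0 ∧ ∀ n : ℕ, ∑ x ∈ s, ∑ y ∈ s, v x * v y *
      criticalTwoPoint 3 (Fin.insertNth i (n : ℤ) (x - y) : Site 3) = ∫ t, t ^ n ∂μ) := by
  intro i s v
  classical
  have hβ : (0 : ℝ) ≤ criticalBeta 3 := criticalBeta_nonneg 3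
  have hm : spontaneousMagnetization (2 + 1) (criticalBeta (2 + 1)) = 0 :=
    spontaneousMagnetization_criticalBeta_eq_zero_holds (d := 2 + 1) (by norm_num)
  obtain ⟨μ, hμfin, hμsupp, hμ⟩ := exists_axisForm_hausdorffMeasure (d' := 2) hβ hm i (fun a : s => v a)
    (fun a : s => (Fin.insertNth i (0 : ℤ) (a : Fin 2 → ℤ) : Site 3)) (fun a => by simp)
  refine ⟨μ, hμfin, hμsupp, fun n => ?_⟩
  rw [← hμ n, axisForm, Finset.sum_comm, ← Finset.sum_coe_sort s]
  refine Finset.sum_congr rfl fun a _ => ?_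
  rw [← Finset.sum_coe_sort s]
  refine Finset.sum_congr rfl fun b _ => ?_
  rw [insertNth_zero_sub_add_single, mul_comm (v b) (v a)]
  rfl

end Summit.CriticalPhenomena.Ising3DConformalLimit.Cruxes.DirectCorrelationStableTail.SelfEnergyPickInversion

end
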